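import Summits.BirchSwinnertonDyer.BirchSwinnertonDyer.Theorems.KolyvaginRoadThreeSchneiderTamAtThreeHeightLogNumeratorSplitDigit
import HarnessLib

/-!
# The split `p`-adic height — THE TWO-TERM LAW `‖ĥ_p^{split}(Q) + A + T₀‖ ≤ max(p⁻¹‖A‖, p⁻¹‖T₀‖, ‖x‖⁻¹)`,
# `A = (num x)^{p−1} − 1`, `T₀ = z²·(c₆/c₄)/N_L`, and `‖log_p q_E + N_L‖ ≤ p⁻¹‖N_L‖` from the integer model

HONEST FRAMING (cell `bsd-stepL`, seat `bsd-stepL-tam3-p2` g4; `--supports stmt-BirchSwinnertonDyer-19154 --as helper`):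
THEOREMS ONLY, route-free; 0 definitions, 0 named facts, 0 sorry. Continuation of `…SplitDigit` (the one-more-digit
lemmas); nothing class-wide about Schneider's conjecture; BSD asserted nowhere.

* `norm_heightSplitCoord_add_add_le` — THE TWO-TERM SPLIT LAW (abstract: given the first-order law for `ĥ_{4.1}` and a
  number `N` with `‖log_p q + N‖ ≤ p⁻¹‖N‖`): both leading terms of the split height are the explicit rationals
  `−A = −((num x)^{p−1} − 1)` and `−T₀ = −z(Q)²·(c₆/c₄)/N`, each to one more digit.
* `norm_padicLog_tateParam_add_intCast_le` — for THE Tate parameter `N = N_L = U^{p−1} − c₄^{6(p−1)}` works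
  (`U = Δ'c₄³ + 744p^νΔ'²`, `Δ = p^νΔ'`, `N_L = p^{v_L}n_L`, `p ∤ n_L`, `v_L + 1 ≤ 2ν`; every Kodaira type `I_ν`, `ν ≥ 1`).

References: [SteinWuthrich2013] §4.2 (p. 16); [SilvermanATAEC1994] Thm. V.3.1(b), Lemma V.5.1; [Iwasawa1972PadicL] §4.4.
-/

noncomputable section

open scoped Classical
open Filter Topology IsUltrametricDist
open WeierstrassCurve Literature.NumberTheory.EllipticCurves
open Literature.NumberTheory.EllipticCurves.SteinWuthrich2013
open Literature.NumberTheory.EllipticCurves.TateCurve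
open Literature.NumberTheory.EllipticCurves.Rank1Residual
open Summit.BirchSwinnertonDyer.Uniform.UI.O2
open Summit.BirchSwinnertonDyer.Rank1Residual Summit.BirchSwinnertonDyer.Rank1Residual.X11b

namespace Summit.BirchSwinnertonDyer.Rank1Residual.X11b.RegMult.HeightLogNumerator

variable {p : ℕ} [Fact p.Prime]

/-! ### §9 The two-term split law -/


section TwoTerm

variable {W : WeierstrassCurve ℚ}

/-- **THE TWO-TERM SPLIT LAW.** `W/ℚ` minimal, multiplicative at the odd prime `p`; `q ≠ 0`, `‖q‖ < 1`; `P = (x, y)`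
rational affine with `‖x‖_p > 1`; GIVEN the first-order law `‖ĥ_{4.1}(P) − log_p num x‖ ≤ ‖x‖⁻¹` and a number `N ≠ 0`
with `‖log_p q + N‖ ≤ p⁻¹‖N‖` (for THE Tate parameter: `N = N_L`, `norm_padicLog_tateParam_add_intCast_le` below):
**`‖ĥ^{split}(P) + A + T₀‖ ≤ max(p⁻¹‖A‖, p⁻¹‖T₀‖, ‖x‖⁻¹)`**, `A = (num x)^{p−1} − 1`, `T₀ = z²·(c₆/c₄)/N`, `z = −x/y`.
[cite: SteinWuthrich2013, §4.2] [cite: Iwasawa1972PadicL, §4.4] -/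
theorem norm_heightSplitCoord_add_add_le (hp2 : p ≠ 2) [W.IsElliptic] [W.IsGloballyMinimal] (hW : Mult W p)
    {q : ℚ_[p]} (hq : ‖q‖ < 1) {x y : ℚ} (hxy : W.toAffine.Nonsingular x y)
    (hx : 1 < ‖(x : ℚ_[p])‖)
    (hlaw : ‖heightFourOneCoord W p q x y - padicLog p ((x.num : ℚ) : ℚ_[p])‖ ≤ ‖(x : ℚ_[p])‖⁻¹)
    {N : ℚ_[p]} (hN0 : N ≠ 0) (hL : ‖padicLog p q + N‖ ≤ (p : ℝ)⁻¹ * ‖N‖) :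
    ‖heightSplitCoord W p q x y + ((((x.num : ℚ) : ℚ_[p])) ^ (p - 1) - 1) +
        (-(x : ℚ_[p]) / y) ^ 2 * ((W.c₆ : ℚ_[p]) / (W.c₄ : ℚ_[p])) / N‖ ≤
      max ((p : ℝ)⁻¹ * ‖(((x.num : ℚ) : ℚ_[p])) ^ (p - 1) - 1‖)
        (max ((p : ℝ)⁻¹ * ‖(-(x : ℚ_[p]) / y) ^ 2 * ((W.c₆ : ℚ_[p]) / (W.c₄ : ℚ_[p])) / N‖) ‖(x : ℚ_[p])‖⁻¹) := by
  have hpP : p.Prime := Fact.out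
  have hp1 : (1 : ℝ) < p := by exact_mod_cast hpP.one_lt
  have hpinv0 : (0 : ℝ) ≤ (p : ℝ)⁻¹ := by positivity
  have hpinv1 : (p : ℝ)⁻¹ < 1 := inv_lt_one_of_one_lt₀ hp1
  -- names
  set h : ℚ_[p] := heightFourOneCoord W p q x y with hh
  set z : ℚ_[p] := -(x : ℚ_[p]) / y with hz
  set ℓ : ℚ_[p] := (W.baseChange ℚ_[p]).padicFormalLog z with hℓ
  set Cinv : ℚ_[p] := (uniformisationScaleSq W p q)⁻¹ with hCinv
  set L : ℚ_[p] := padicLog p q with hLdef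
  set r46 : ℚ_[p] := (W.c₆ : ℚ_[p]) / (W.c₄ : ℚ_[p]) with hr46
  -- `num x` is an integer prime to `p`
  have hd0 : ((x.den : ℚ) : ℚ_[p]) ≠ 0 := by exact_mod_cast x.den_nz
  have hnum1 : ‖((x.num : ℚ) : ℚ_[p])‖ = 1 := norm_num_eq_one_padic hx
  have hpa : ¬ (p : ℤ) ∣ x.num := by
    intro hd
    have : ‖((x.num : ℚ) : ℚ_[p])‖ < 1 := by rw [Rat.cast_intCast]; exact Padic.norm_intCast_lt_one_iff.mpr hd
    rw [hnum1] at this; exact lt_irrefl _ this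
  -- the three relative errors
  have hX : ‖ℓ ^ 2 - z ^ 2‖ ≤ (p : ℝ)⁻¹ * ‖z ^ 2‖ := by
    rw [norm_pow]; exact norm_padicFormalLog_sq_sub_sq_le hp2 hxy hx
  have h4 : ‖(W.c₄ : ℚ_[p])‖ = 1 := norm_c₄_eq_one_of_hasMultiplicativeReductionAtPrime hW
  have h6 : ‖(W.c₆ : ℚ_[p])‖ = 1 := norm_c₆_eq_one_of_mult hW
  have hr46n : ‖-r46‖ = 1 := by rw [norm_neg, hr46, norm_div, h4, h6, div_one]
  have hqle : ‖q‖ ≤ (p : ℝ)⁻¹ := by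
    have h := (Padic.norm_le_pow_iff_norm_lt_pow_add_one q (-1)).mpr (by rw [neg_add_cancel, zpow_zero]; exact hq)
    rwa [zpow_neg_one] at h
  have hY : ‖Cinv - (-r46)‖ ≤ (p : ℝ)⁻¹ * ‖-r46‖ := by
    rw [hr46n, mul_one, sub_neg_eq_add]
    exact (norm_inv_uniformisationScaleSq_add_le hW hq).trans hqle
  have hV : ‖L - (-N)‖ ≤ (p : ℝ)⁻¹ * ‖-N‖ := by rw [sub_neg_eq_add, norm_neg]; exact hL
  have hT : ‖ℓ ^ 2 * Cinv / L - z ^ 2 * (-r46) / (-N)‖ ≤ (p : ℝ)⁻¹ * ‖z ^ 2 * (-r46) / (-N)‖ :=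
    norm_mul_div_sub_le_of_rel hpinv0 hpinv1 (neg_ne_zero.mpr hN0) hX hY hV
  have hT0 : z ^ 2 * (-r46) / (-N) = z ^ 2 * r46 / N := by rw [mul_neg, neg_div_neg_eq]
  rw [hT0] at hT
  -- the split height in these names
  have hsplit : heightSplitCoord W p q x y = h - ℓ ^ 2 * Cinv / L := by
    rw [heightSplitCoord_eq_sub, hh, hℓ, hz, hCinv, hLdef]
    unfold logUnitParamSq
    rw [div_eq_mul_inv _ (uniformisationScaleSq W p q)]
  -- the numerator digit
  have hA : ‖padicLog p ((x.num : ℚ) : ℚ_[p]) + ((((x.num : ℚ) : ℚ_[p])) ^ (p - 1) - 1)‖ ≤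
      (p : ℝ)⁻¹ * ‖(((x.num : ℚ) : ℚ_[p])) ^ (p - 1) - 1‖ := by
    rw [Rat.cast_intCast]; exact norm_padicLog_intCast_add_le hp2 hpa
  -- assemble
  have e : heightSplitCoord W p q x y + ((((x.num : ℚ) : ℚ_[p])) ^ (p - 1) - 1) + z ^ 2 * r46 / N =
      (h - padicLog p ((x.num : ℚ) : ℚ_[p])) +
        (padicLog p ((x.num : ℚ) : ℚ_[p]) + ((((x.num : ℚ) : ℚ_[p])) ^ (p - 1) - 1)) -
        (ℓ ^ 2 * Cinv / L - z ^ 2 * r46 / N) := by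
    rw [hsplit]; ring
  rw [e, sub_eq_add_neg]
  refine (IsUltrametricDist.norm_add_le_max _ _).trans (max_le ?_ ?_)
  · refine (IsUltrametricDist.norm_add_le_max _ _).trans (max_le ?_ ?_)
    · exact hlaw.trans (le_max_of_le_right (le_max_right _ _))
    · exact hA.trans (le_max_left _ _)
  · rw [norm_neg]; exact hT.trans (le_max_of_le_right (le_max_left _ _))

/-- **`‖log_p q_E + N_L‖ ≤ p⁻¹·‖N_L‖` from the integer model** (every Kodaira type `I_ν`, `ν ≥ 1`): as
`norm_padicLog_tateParam_eq_of_model` (`…Split`), one digit further: `log_p q ≡ −(u₁^{p−1} − 1) ≡ −N_L/c₄^{6(p−1)} ≡ −N_L`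
(`c₄^{p−1} ≡ 1`). Hypotheses: `N_L = p^{v_L}·n_L`, `p ∤ n_L`, `v_L + 1 ≤ 2ν`.
[cite: SilvermanATAEC1994, Thm. V.3.1(b), Lemma V.5.1] [cite: Iwasawa1972PadicL, §4.4] -/
theorem norm_padicLog_tateParam_add_intCast_le (hp2 : p ≠ 2) (W : WeierstrassCurve ℚ) {a₁ a₂ a₃ a₄ a₆ : ℤ}
    (hW : W = ⟨a₁, a₂, a₃, a₄, a₆⟩) [W.IsElliptic] {c4 Dp U NL nL : ℤ} {ν vL : ℕ}
    (hc4 : c4 = (a₁ ^ 2 + 4 * a₂) ^ 2 - 24 * (2 * a₄ + a₁ * a₃))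
    (hD : (p : ℤ) ^ ν * Dp = -(a₁ ^ 2 + 4 * a₂) ^ 2 * (a₁ ^ 2 * a₆ + 4 * a₂ * a₆ - a₁ * a₃ * a₄ + a₂ * a₃ ^ 2 - a₄ ^ 2) -
      8 * (2 * a₄ + a₁ * a₃) ^ 3 - 27 * (a₃ ^ 2 + 4 * a₆) ^ 2 + 9 * (a₁ ^ 2 + 4 * a₂) * (2 * a₄ + a₁ * a₃) * (a₃ ^ 2 + 4 * a₆))
    (hpc4 : ¬ (p : ℤ) ∣ c4) (hpDp : ¬ (p : ℤ) ∣ Dp)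
    (hU : U = Dp * c4 ^ 3 + 744 * (p : ℤ) ^ ν * Dp ^ 2) (hNL : NL = U ^ (p - 1) - c4 ^ (6 * (p - 1)))
    (hnL : NL = (p : ℤ) ^ vL * nL) (hpnL : ¬ (p : ℤ) ∣ nL) (hvL : vL + 1 ≤ 2 * ν)
    {q : ℚ_[p]} (hq0 : q ≠ 0) (hq : ‖q‖ < 1) (hj : tateJ q = (W.j : ℚ_[p])) :
    ‖padicLog p q + (NL : ℚ_[p])‖ ≤ (p : ℝ)⁻¹ * ‖(NL : ℚ_[p])‖ := by
  have hpP : p.Prime := Fact.out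
  have hp1 : (1 : ℝ) < p := by exact_mod_cast hpP.one_lt
  have hpR : (0 : ℝ) < p := by positivity
  have hc4n : ‖(c4 : ℚ_[p])‖ = 1 := BinaryQuartic.norm_intCast_eq_one hpc4
  have hDpn : ‖(Dp : ℚ_[p])‖ = 1 := BinaryQuartic.norm_intCast_eq_one hpDp
  have hc40 : (c4 : ℚ_[p]) ≠ 0 := norm_pos_iff.mp (by rw [hc4n]; exact one_pos)
  -- `‖NL‖ = p^{−vL}`
  have hNLn : ‖(NL : ℚ_[p])‖ = (p : ℝ) ^ (-(vL : ℤ)) := by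
    have h1 : (p : ℤ) ^ vL ∣ NL := ⟨nL, hnL⟩
    have h2 : ¬ (p : ℤ) ^ (vL + 1) ∣ NL := by
      rintro ⟨t, ht⟩
      apply hpnL
      refine ⟨t, ?_⟩
      have hp0 : (p : ℤ) ^ vL ≠ 0 := pow_ne_zero _ (by exact_mod_cast hpP.ne_zero)
      have : (p : ℤ) ^ vL * nL = (p : ℤ) ^ vL * (p * t) := by rw [← hnL, ht]; ring
      exact mul_left_cancel₀ hp0 this
    exact GaloisImage.PadicSquareClass.norm_intCast_padic_eq h1 h2
  -- `1/j`, `‖q‖`, `ord q` (as in `…Split`)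
  have hJ : (tateJ q)⁻¹ = (p : ℚ_[p]) ^ ν * (Dp : ℚ_[p]) / (c4 : ℚ_[p]) ^ 3 := by
    rw [hj, ratCast_j_inv_eq_padic (p := p) W hW hc4 hD]; push_cast; ring
  have hpn : ‖(p : ℚ_[p]) ^ ν‖ = (p : ℝ) ^ (-(ν : ℤ)) := by
    rw [norm_pow, Padic.norm_p, ← zpow_natCast, inv_zpow']
  have hqn : ‖q‖ = (p : ℝ) ^ (-(ν : ℤ)) := by
    rw [← inv_inv ‖q‖, ← norm_tateJ_eq hq, ← norm_inv, hJ, norm_div, norm_mul, hpn, norm_pow, hc4n, hDpn,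
      one_pow, div_one, mul_one]
  have hval : q.valuation = ν := by
    have h := Padic.norm_eq_zpow_neg_valuation hq0
    rw [hqn] at h
    have := zpow_right_injective₀ hpR hp1.ne' h
    omega
  set u₁ : ℚ_[p] := (U : ℚ_[p]) / (c4 : ℚ_[p]) ^ 6 with hu₁
  have hp0 : (p : ℚ_[p]) ≠ 0 := by exact_mod_cast hpP.ne_zero
  have hu₁eq : ((tateJ q)⁻¹ + 744 * (tateJ q)⁻¹ ^ 2) * (p : ℚ_[p]) ^ (-q.valuation) = u₁ := by
    rw [hval, hJ, hu₁, hU, zpow_neg, zpow_natCast]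
    push_cast
    field_simp
  have hu₁n : ‖u₁‖ ≤ 1 := by
    rw [hu₁, norm_div, norm_pow, hc4n, one_pow, div_one]; exact Padic.norm_int_le_one _
  have hB₁eq : u₁ ^ (p - 1) - 1 = (NL : ℚ_[p]) / (c4 : ℚ_[p]) ^ (6 * (p - 1)) := by
    rw [hNL, hu₁]; push_cast
    rw [div_pow, ← pow_mul, sub_div, div_self (pow_ne_zero _ hc40)]
  have hB₁n : ‖u₁ ^ (p - 1) - 1‖ = (p : ℝ) ^ (-(vL : ℤ)) := by
    rw [hB₁eq, norm_div, norm_pow, hc4n, one_pow, div_one, hNLn]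
  have hB₁0 : u₁ ^ (p - 1) - 1 ≠ 0 := norm_pos_iff.mp (by rw [hB₁n]; positivity)
  -- the approximation is good to `p^{−2ν} ≤ p^{−(vL+1)} = p⁻¹‖B₁‖`
  have happ : ‖q * (p : ℚ_[p]) ^ (-q.valuation) - u₁‖ ≤ (p : ℝ)⁻¹ * ‖u₁ ^ (p - 1) - 1‖ := by
    rw [hB₁n, ← hu₁eq]
    refine (norm_unitPart_tateParam_sub_le hq0 hq).trans ?_
    rw [hqn, ← zpow_natCast, ← zpow_mul, ← zpow_neg_one, ← zpow_add₀ hpR.ne']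
    exact zpow_le_zpow_right₀ hp1.le (by push_cast; omega)
  have hmain := norm_padicLog_add_unitApprox_le hp2 hq0 hu₁n hB₁0 happ
  -- replace `B₁ = NL/c4^{6(p−1)}` by `NL`: `‖NL/c4^{6(p-1)} − NL‖ ≤ p⁻¹‖NL‖` (Fermat)
  have hF : ‖(NL : ℚ_[p]) / (c4 : ℚ_[p]) ^ (6 * (p - 1)) - (NL : ℚ_[p])‖ ≤ (p : ℝ)⁻¹ * ‖(NL : ℚ_[p])‖ := by
    have hcp : ‖((c4 : ℚ_[p]) ^ 6) ^ (p - 1) - 1‖ < 1 :=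
      norm_pow_sub_one_lt_one_of_norm_eq_one (by rw [norm_pow, hc4n, one_pow])
    have hcp' : ‖((c4 : ℚ_[p]) ^ 6) ^ (p - 1) - 1‖ ≤ (p : ℝ)⁻¹ := by
      have hint : ((c4 : ℚ_[p]) ^ 6) ^ (p - 1) - 1 = (((c4 ^ 6) ^ (p - 1) - 1 : ℤ) : ℚ_[p]) := by push_cast; ring
      rw [hint] at hcp ⊢
      have hdvd := Padic.norm_intCast_lt_one_iff.mp hcp
      have h := (Padic.norm_int_le_pow_iff_dvd ((c4 ^ 6) ^ (p - 1) - 1) 1).mpr (by simpa using hdvd)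
      simpa using h
    have hc0 : (c4 : ℚ_[p]) ^ (6 * (p - 1)) ≠ 0 := pow_ne_zero _ hc40
    have e : (NL : ℚ_[p]) / (c4 : ℚ_[p]) ^ (6 * (p - 1)) - (NL : ℚ_[p]) =
        -((NL : ℚ_[p]) * (((c4 : ℚ_[p]) ^ 6) ^ (p - 1) - 1) / (c4 : ℚ_[p]) ^ (6 * (p - 1))) := by
      rw [← pow_mul]; field_simp; ring
    rw [e, norm_neg, norm_div, norm_mul, norm_pow, hc4n, one_pow, div_one, mul_comm]
    exact mul_le_mul_of_nonneg_right hcp' (norm_nonneg _)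
  have e2 : padicLog p q + (NL : ℚ_[p]) =
      (padicLog p q + (u₁ ^ (p - 1) - 1)) - ((NL : ℚ_[p]) / (c4 : ℚ_[p]) ^ (6 * (p - 1)) - (NL : ℚ_[p])) := by
    rw [hB₁eq]; ring
  rw [e2, sub_eq_add_neg]
  refine (IsUltrametricDist.norm_add_le_max _ _).trans (max_le ?_ (by rw [norm_neg]; exact hF))
  rw [hB₁n, ← hNLn] at hmain
  exact hmain

end TwoTerm

/-! ### §10 The DIGIT ROW CHECKER (`p ≥ 5`) -/

section DigitChecker

/-- **Generic FIRST-DIGIT SPLIT ROW CHECKER at `p ≥ 5`.** For `W = ⟨a₁,…,a₆⟩` globally minimal, multiplicative at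
`p ≥ 5`, the point `Q = (a/e², b/e³)` on `W` with `e = p^k e'`, `k ≥ 1`, `p ∤ e'`, `p ∤ b`, `gcd(a, e) = 1`; the integer
data `c₄, c₆`, `Δ = p^νΔ'` (`p ∤ c₄Δ'`), `U = Δ'c₄³ + 744p^νΔ'²`, `N_L = U^{p−1} − c₄^{6(p−1)} = p^{v_L}·n_L`, `p ∤ n_L`,
`1 ≤ v_L`, `v_L + 1 ≤ 2ν`; and the DIGIT data `α + v_L = 2k`, `p^α·m = a^{p−1} − 1` (so `v_p(a^{p−1} − 1) ≥ α`: exactly the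
rows where the valuation checker of `…SplitChecker` is silent or the 𝓛-term leads):
**`p ∤ m·b²c₄n_L + a²e'²c₆ ⟹ heightSplitCoord W p q x(Q) y(Q) ≠ 0`** for every Tate parameter `q` (indeed
`‖ĥ^{split}(Q)‖ = p^{−α}`). The two-term law: `ĥ^{split} ≡ −A − T₀ (mod p^{α+1})` with `A = p^α m`,
`T₀ = p^α·a²e'²c₆/(b²c₄n_L)`. [cite: SteinWuthrich2013, §4.2] [cite: Iwasawa1972PadicL, §4.4] -/
theorem heightSplitCoord_ne_zero_of_digitRow_padic (hp5 : 5 ≤ p) (W : WeierstrassCurve ℚ) {a₁ a₂ a₃ a₄ a₆ : ℤ}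
    (hW : W = ⟨a₁, a₂, a₃, a₄, a₆⟩) [W.IsElliptic] [W.IsGloballyMinimal] (hWm : Mult W p)
    {a b c4 c6 Dp U NL nL m : ℤ} {e' k ν vL α : ℕ}
    (H : ¬ p ∣ e' ∧ 1 ≤ k ∧ Nat.Coprime a.natAbs (p ^ k * e') ∧ ¬ (p : ℤ) ∣ b ∧
      c4 = (a₁ ^ 2 + 4 * a₂) ^ 2 - 24 * (2 * a₄ + a₁ * a₃) ∧
      c6 = -(a₁ ^ 2 + 4 * a₂) ^ 3 + 36 * (a₁ ^ 2 + 4 * a₂) * (2 * a₄ + a₁ * a₃) - 216 * (a₃ ^ 2 + 4 * a₆) ∧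
      (p : ℤ) ^ ν * Dp = -(a₁ ^ 2 + 4 * a₂) ^ 2 * (a₁ ^ 2 * a₆ + 4 * a₂ * a₆ - a₁ * a₃ * a₄ + a₂ * a₃ ^ 2 - a₄ ^ 2) -
        8 * (2 * a₄ + a₁ * a₃) ^ 3 - 27 * (a₃ ^ 2 + 4 * a₆) ^ 2 +
        9 * (a₁ ^ 2 + 4 * a₂) * (2 * a₄ + a₁ * a₃) * (a₃ ^ 2 + 4 * a₆) ∧
      ¬ (p : ℤ) ∣ c4 ∧ ¬ (p : ℤ) ∣ Dp ∧
      U = Dp * c4 ^ 3 + 744 * (p : ℤ) ^ ν * Dp ^ 2 ∧ NL = U ^ (p - 1) - c4 ^ (6 * (p - 1)) ∧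
      NL = (p : ℤ) ^ vL * nL ∧ ¬ (p : ℤ) ∣ nL ∧ 1 ≤ vL ∧ vL + 1 ≤ 2 * ν ∧
      α + vL = 2 * k ∧ (p : ℤ) ^ α * m = a ^ (p - 1) - 1 ∧
      ¬ (p : ℤ) ∣ m * b ^ 2 * c4 * nL + a ^ 2 * (e' : ℤ) ^ 2 * c6)
    {x y : ℚ} (hx : x = a / ((p ^ k * e' : ℕ) : ℚ) ^ 2) (hy : y = b / ((p ^ k * e' : ℕ) : ℚ) ^ 3)
    (hP : W.toAffine.Equation x y)
    {q : ℚ_[p]} (hq0 : q ≠ 0) (hq : ‖q‖ < 1) (hj : tateJ q = (W.j : ℚ_[p])) :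
    heightSplitCoord W p q x y ≠ 0 := by
  obtain ⟨hpe', hk, hcop, hpb, hc4, hc6, hD, hpc4, hpDp, hU, hNL, hnL, hpnL, hvL1, hvL, hαk, hm, hcrit⟩ := H
  have hpP : p.Prime := Fact.out
  have hp2 : p ≠ 2 := by omega
  have hp1 : (1 : ℝ) < p := by exact_mod_cast hpP.one_lt
  have hpR : (0 : ℝ) < p := by positivity
  have hp0 : (p : ℚ_[p]) ≠ 0 := by exact_mod_cast hpP.ne_zero
  have he'0 : e' ≠ 0 := by rintro rfl; exact hpe' (dvd_zero p)
  have he0 : (p ^ k * e' : ℕ) ≠ 0 := Nat.mul_ne_zero (pow_ne_zero _ hpP.ne_zero) he'0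
  have hpe : p ∣ p ^ k * e' := dvd_mul_of_dvd_left (dvd_pow_self p (by omega)) _
  have h : W.toAffine.Nonsingular x y :=
    (WeierstrassCurve.Affine.equation_iff_nonsingular (W := W.toAffine)).mp hP
  have hx1 : 1 < ‖(x : ℚ_[p])‖ :=
    (one_lt_norm_ratCast_iff p x).mpr (KernelCert.padicValRat_x_neg he0 hx hcop hpe)
  -- unit norms
  have hbn : ‖(b : ℚ_[p])‖ = 1 := BinaryQuartic.norm_intCast_eq_one hpb
  have hc4n : ‖(c4 : ℚ_[p])‖ = 1 := BinaryQuartic.norm_intCast_eq_one hpc4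
  have hnLn : ‖(nL : ℚ_[p])‖ = 1 := BinaryQuartic.norm_intCast_eq_one hpnL
  have hb0 : (b : ℚ_[p]) ≠ 0 := norm_pos_iff.mp (by rw [hbn]; exact one_pos)
  have hc40 : (c4 : ℚ_[p]) ≠ 0 := norm_pos_iff.mp (by rw [hc4n]; exact one_pos)
  have hnL0 : (nL : ℚ_[p]) ≠ 0 := norm_pos_iff.mp (by rw [hnLn]; exact one_pos)
  have he'Q0 : (e' : ℚ_[p]) ≠ 0 := by exact_mod_cast he'0
  have hbZ : b ≠ 0 := fun hb => hpb (hb ▸ dvd_zero _)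
  have hbQ : (b : ℚ) ≠ 0 := by exact_mod_cast hbZ
  -- `num x = a`
  set E : ℕ := p ^ k * e' with hEdef
  have hcop2 : Nat.Coprime a.natAbs (((E : ℤ) ^ 2).natAbs) := by
    rw [Int.natAbs_pow, Int.natAbs_natCast]; exact hcop.pow_right 2
  have hE2pos : (0 : ℤ) < (E : ℤ) ^ 2 := by positivity
  have hxq : x = ((a : ℤ) : ℚ) / (((E : ℤ) ^ 2 : ℤ) : ℚ) := by rw [hx]; push_cast; ring
  have hnum : x.num = a := by rw [hxq]; exact Rat.num_div_eq_of_coprime hE2pos hcop2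
  -- the model's `c₄`, `c₆` in `ℚ_p`, and `N_L`
  have hWc4 : (W.c₄ : ℚ_[p]) = (c4 : ℚ_[p]) := by
    have : W.c₄ = (c4 : ℚ) := by
      subst hW; rw [hc4]; simp only [WeierstrassCurve.c₄, WeierstrassCurve.b₂, WeierstrassCurve.b₄]; push_cast; ring
    rw [this]; push_cast; rfl
  have hWc6 : (W.c₆ : ℚ_[p]) = (c6 : ℚ_[p]) := by
    have : W.c₆ = (c6 : ℚ) := by
      subst hW; rw [hc6]
      simp only [WeierstrassCurve.c₆, WeierstrassCurve.b₂, WeierstrassCurve.b₄, WeierstrassCurve.b₆]; push_cast; ring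
    rw [this]; push_cast; rfl
  have hNLn : ‖(NL : ℚ_[p])‖ = (p : ℝ) ^ (-(vL : ℤ)) := by
    rw [hnL]; push_cast
    rw [norm_mul, norm_pow, Padic.norm_p, hnLn, mul_one, ← zpow_natCast, inv_zpow']
  have hNL0 : (NL : ℚ_[p]) ≠ 0 := norm_pos_iff.mp (by rw [hNLn]; positivity)
  -- the two-term law at this point
  have hL := norm_padicLog_tateParam_add_intCast_le hp2 W hW hc4 hD hpc4 hpDp hU hNL hnL hpnL hvL hq0 hq hj
  have hlaw := norm_heightFourOneCoord_sub_padicLog_num_le_padic hp5 hWm hq h hx1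
  have htwo := norm_heightSplitCoord_add_add_le hp2 hWm hq h hx1 hlaw hNL0 hL
  -- identify `A = p^α m` and `T₀ = p^α t`
  set t : ℚ_[p] := (a : ℚ_[p]) ^ 2 * (e' : ℚ_[p]) ^ 2 * (c6 : ℚ_[p]) / ((b : ℚ_[p]) ^ 2 * (c4 : ℚ_[p]) * (nL : ℚ_[p]))
    with ht
  have hAeq : (((x.num : ℚ) : ℚ_[p])) ^ (p - 1) - 1 = (p : ℚ_[p]) ^ α * (m : ℚ_[p]) := by
    rw [hnum, Rat.cast_intCast]; exact_mod_cast hm.symm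
  have hT0eq : (-(x : ℚ_[p]) / y) ^ 2 * ((W.c₆ : ℚ_[p]) / (W.c₄ : ℚ_[p])) / (NL : ℚ_[p]) = (p : ℚ_[p]) ^ α * t := by
    have hxQ : (x : ℚ_[p]) = (a : ℚ_[p]) / ((p : ℚ_[p]) ^ k * (e' : ℚ_[p])) ^ 2 := by
      rw [hx, hEdef]; push_cast; ring
    have hyQ : ((y : ℚ) : ℚ_[p]) = (b : ℚ_[p]) / ((p : ℚ_[p]) ^ k * (e' : ℚ_[p])) ^ 3 := by
      rw [hy, hEdef]; push_cast; ring
    have h2k : (p : ℚ_[p]) ^ (2 * k) = (p : ℚ_[p]) ^ α * (p : ℚ_[p]) ^ vL := by rw [← pow_add, hαk]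
    rw [hWc4, hWc6, hnL, hxQ, hyQ, ht]; push_cast
    field_simp
    rw [show ((p : ℚ_[p]) ^ k) ^ 2 = (p : ℚ_[p]) ^ α * (p : ℚ_[p]) ^ vL from by rw [← pow_mul, mul_comm, h2k]]
    ring
  have htn : ‖t‖ ≤ 1 := by
    rw [ht, norm_div, norm_mul, norm_mul, norm_mul, norm_mul, norm_pow, norm_pow, norm_pow, hbn, hc4n, hnLn]
    simp only [one_pow, mul_one, div_one]
    have ha := Padic.norm_int_le_one (p := p) a
    have he := Padic.norm_int_le_one (p := p) (e' : ℤ)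
    have hc := Padic.norm_int_le_one (p := p) c6
    push_cast at he
    calc ‖(a : ℚ_[p])‖ ^ 2 * ‖(e' : ℚ_[p])‖ ^ 2 * ‖(c6 : ℚ_[p])‖ ≤ 1 ^ 2 * 1 ^ 2 * 1 := by
          gcongr
      _ = 1 := by norm_num
  have hpα : ‖(p : ℚ_[p]) ^ α‖ = (p : ℝ) ^ (-(α : ℤ)) := by
    rw [norm_pow, Padic.norm_p, ← zpow_natCast, inv_zpow']
  -- the error is `≤ p^{−(α+1)}`
  have herr : ‖heightSplitCoord W p q x y + (p : ℚ_[p]) ^ α * (m : ℚ_[p]) + (p : ℚ_[p]) ^ α * t‖ ≤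
      (p : ℝ) ^ (-((α : ℤ) + 1)) := by
    rw [hAeq, hT0eq] at htwo
    have hpow1 : (p : ℝ) ^ (-((α : ℤ) + 1)) = (p : ℝ)⁻¹ * ((p : ℝ) ^ (-(α : ℤ)) * 1) := by
      rw [mul_one, neg_add, zpow_add₀ hpR.ne', zpow_neg_one, mul_comm]
    refine htwo.trans (max_le ?_ (max_le ?_ ?_))
    · rw [norm_mul, hpα, hpow1]
      gcongr
      exact Padic.norm_int_le_one _
    · rw [norm_mul, hpα, hpow1]
      gcongr
    · -- `‖x‖⁻¹ = p^{−2k} ≤ p^{−(α+1)}`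
      have he'n : ‖(e' : ℚ_[p])‖ = 1 := by
        rw [show (e' : ℚ_[p]) = ((e' : ℤ) : ℚ_[p]) by norm_cast]
        exact BinaryQuartic.norm_intCast_eq_one (fun hd => hpe' (by exact_mod_cast hd))
      have hpa : ¬ (p : ℤ) ∣ a := by
        intro hd
        have h1' : p ∣ a.natAbs := Int.natCast_dvd.mp hd
        have h2' : p ∣ Nat.gcd a.natAbs (p ^ k * e') := Nat.dvd_gcd h1' hpe
        rw [hcop] at h2'
        exact hpP.one_lt.ne' (Nat.dvd_one.mp h2')
      have hxinv : ‖(x : ℚ_[p])‖⁻¹ = (p : ℝ) ^ (-((2 * k : ℕ) : ℤ)) := by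
        have hxp : (x : ℚ_[p]) = (a : ℚ_[p]) / ((p : ℚ_[p]) ^ k * (e' : ℚ_[p])) ^ 2 := by
          rw [hx, hEdef]; push_cast; ring
        rw [hxp, norm_div, BinaryQuartic.norm_intCast_eq_one hpa, norm_pow, norm_mul, norm_pow, Padic.norm_p, he'n,
          mul_one, one_div, inv_inv, ← zpow_natCast, ← zpow_natCast, ← zpow_mul, inv_zpow']
        congr 1; push_cast; ring
      rw [hxinv]
      exact zpow_le_zpow_right₀ hp1.le (by push_cast; omega)
  -- the main term has norm exactly `p^{−α}`
  have hmain : ‖(p : ℚ_[p]) ^ α * (m : ℚ_[p]) + (p : ℚ_[p]) ^ α * t‖ = (p : ℝ) ^ (-(α : ℤ)) := by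
    have e : (p : ℚ_[p]) ^ α * (m : ℚ_[p]) + (p : ℚ_[p]) ^ α * t =
        (p : ℚ_[p]) ^ α * (((m * b ^ 2 * c4 * nL + a ^ 2 * (e' : ℤ) ^ 2 * c6 : ℤ) : ℚ_[p]) /
          ((b : ℚ_[p]) ^ 2 * (c4 : ℚ_[p]) * (nL : ℚ_[p]))) := by
      rw [ht]; push_cast; field_simp
    rw [e, norm_mul, hpα, norm_div, BinaryQuartic.norm_intCast_eq_one hcrit, norm_mul, norm_mul, norm_pow, hbn, hc4n,
      hnLn]
    norm_num
  -- conclude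
  intro h0
  have hsum : heightSplitCoord W p q x y + (p : ℚ_[p]) ^ α * (m : ℚ_[p]) + (p : ℚ_[p]) ^ α * t =
      (p : ℚ_[p]) ^ α * (m : ℚ_[p]) + (p : ℚ_[p]) ^ α * t := by rw [h0, zero_add]
  rw [hsum, hmain] at herr
  have : (p : ℝ) ^ (-(α : ℤ)) > (p : ℝ) ^ (-((α : ℤ) + 1)) := zpow_lt_zpow_right₀ hp1 (by omega)
  exact absurd herr (not_le.mpr this)

end DigitChecker

end Summit.BirchSwinnertonDyer.Rank1Residual.X11b.RegMult.HeightLogNumerator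

end
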